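import Literature.MathematicalPhysics.QuantumFieldTheory.Balaban1983to89.B9SectCDiffCutModelToy14

/-!
# `Balaban1983to89.B9SectCDiffCutModelToy15` — THE FULL (3.97) SHAPE IN THE TOY: TWO DIFFERENT OPERATOR SEQUENCES
**AND** THE SMOOTH CUTOFF — the datum `Xhv` (Toy11's potential datum `Xpot` with Toy14's intertwiners
`χ = diag(h₄)`, `ψ = cutX(h₄ ∘ x_S)`), its complete `CutModel` (`θ = θ_X + t`), THEOREM D's conclusion for it on
the decaying frame, and the SHADOW POTENTIAL instance (two different backgrounds that agree on the support of the
cutoff, every defect `O(M⁻¹)`) (census `b2b-balaban-r1/SectC-inst-census.md` §6 (a⁵) ff.; note N21)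

B9 = T. Bałaban, *Propagators for lattice gauge theories in a background field*, Commun. Math. Phys. **99**, 389–434
(1985) [Balaban1985BackgroundPropagators].

CITATION HEADER (lean-in-tree rule 2026-08-18).  Cell `pub-balaban`, unit `b2b-balaban-r1-g21` (READER GROUP A,
lineage r1, gen 21), journal claim `SECTC-DIFF-CUTMODEL-TOY15` (successor of the same lineage's `…Toy14` under claim
`SECTC-DIFF-CUTMODEL-TOY14`).  Source: doi:10.1007/bf01240355, held `paper:balaban1985-cmp99-background-propagators`,
journal page = PDF page + 388.  This unit re-read NO page and introduces NO quotation: the printed shapes used here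
are the cut-model hypothesis structure `CutModel` (the cutoff facts and the h-free records typed from (3.102),
p. 414 [PDF 26], and the one-sided forms of (3.100), p. 413 [PDF 25] — both quoted VERBATIM in the headers of
`…B9SectCDiffCutModel` / `…B9SectCDiffEstimate`; the p. 414 sentences on the proper scale and on the commutator
`[Δ′, h]` are quoted in `…B9SectCDiffAssembly`'s `LDat` docstring and in `…B9SectCDiffEstimate`'s header
respectively), the 40-field hypothesis record `EstHyp` of THEOREM D (Theorem 3.1 (3.42), p. 397 [PDF 9]) and its
conclusion `EstHyp.dT_entry` (the typed (3.97), p. 412 [PDF 24]); the present declarations point to those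
quotations BY NAME only.  Tree inputs (by name): `B9SectCDiff.{tdef, tdef_def, tdef_add, cutX}`,
`B9SectCDiffEstimate.{OpZon, EstHyp, EstHyp.dT_entry}`, `B9SectCDiffDict.{opZon_mono, opZon_add}`,
`B9SectCDiffAssembly.{MOne, MTwo, LDat, assemble}`, `B9SectCDiffExpansion.{TwoSeq, TwoSeq.dT}`,
`B9SectCDiffCutModel.{CutModel, CutModel.theta, CutModel.theta_nonneg, CutModel.toLDat, cutX_id_id}`,
`B9SectCDiffCutModelToy.{dE, bdist, rampZone, mem_rampZone, rampZone_nonempty, ramp_eq_zero_of_le, Qp, Qp_rowsum,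
xS, opLoc_Qp}`, `B9SectCDiffCutModelToy2.{Qpt, locQp1}`, `B9SectCDiffCutModelToy3.{toyFrame, toyFrame_valid,
opLoc_toy, opLoc_zero, opDec_Qpt, opDec_of_rowsum}`, `B9SectCDiffCutModelToy4.{ι, ι_eq, Sh, Dfw, Dbw, Th, Xi,
leibniz_affine, opLoc_Dfw, opLoc_Dbw, sstep_zero, h4, h4_eq, h4_nonneg, h4_le_one, h4_modulus, h4_zone, lt_of_hIM}`,
`B9SectCDiffCutModelToy5.Gr`, `B9SectCDiffCutModelToy6.E2`, `B9SectCDiffCutModelToy8.{Lam, Gtoy}`,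
`B9SectCDiffCutModelToy9.{opDec_toy_mono}`, `B9SectCDiffCutModelToy10.{muB_pos, mOne_of_seq1}`,
`B9SectCDiffCutModelToy11.{Gv, Ev, Gtoyv, Gv_ne_Gr, Gtoyv_opDec_num, DbwGtoyv_opDec_num, Gv_opDec_num,
DGv_opDec_num, Ev_inv_opDec_num, bundle_consts_v, mOne_toy_mono, ha20_of, haB_of, Xpot}`,
`B9SectCDiffCutModelToy12.{opZon_diagonal_toy, hBnat_of, abs_v_le, one_le_c, vzone}`,
`B9SectCDiffCutModelToy13.{Kg, Kg_nonneg, const_pow_le, toyFrameD, toyFrameD_valid, toyFrameD_σ,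
toyFrameD_profile₁, mOne_toyD, mTwo_toyD, ldatToyD}` (and the field simp lemmas of `toyFrameD`),
`B9SectCDiffCutModelToy14.{thetaH, thetaH_nonneg, h4_zLm₁bw, h4_zDm₁bw, h4_zXiSt, h4_zAm₁H, h4_zAm₀H, dDDt_eq_bw,
D_mul_dDt_bw, opLoc_Qpt, locQpt2, thetaX, thetaX_nonneg, thetaX_le}`; Mathlib otherwise.  Cell rows: GAPS C-r1g13-1
(the cut model), C-r1g14-1 … C-r1g20-1 (the toys 1–14), this module's row C-r1g21-1; census §6 (a⁵) / notes
N10–N21.  No `HarnessLib` fact, no named-fact `Prop`, no `instance`, no new predicate; no `sorry`.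

## WHAT THIS MODULE DOES

Toy14 ran the cell's THEOREM D pipeline on genuine `∂ ≠ 0` operators WITH a genuine smooth cutoff, but for two
EQUAL operator sequences, so that `𝔇(T)` degenerated to the commutator `[h, Q′GQ′*]` (its caveat (1)); Toy11–Toy13
ran it on two DIFFERENT sequences (a potential on sequence 2) but with trivial intertwiners.  This module does both
at once — the shape of (3.97) as printed: a cutoff `h` AND two background-dependent sequences.

* §1 **THE DATUM `Xhv n B M I₀ a v ha haB hv0 hv1`** (parametric in a site potential `0 ≤ v ≤ 3(a/B)²`,
  `2²⁴ ≤ a`, `2a ≤ B`): Toy11's `Xpot` — sequence 1 = Toy10's genuine operators (`G = Gtoy`, `G′ = Gr`,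
  `C = E₂⁻¹`, `A′₁ = 0`), sequence 2 = the potential ones (`A′₂ = diag v`, `G′₂ = G_v`, `C₂ = E_v⁻¹`,
  `G₂ = G_v,toy`), common `∂ = Dfw`, `∂* = Dbw`, `Λ`, `Λ′ = μ·1`, `Q = Q′ = Qp`, `Q* = Q′* = Qpt` — with Toy14's
  intertwiners **`χs = χb = diag(h₄)`**, **`ψS = ψB = cutX id id (h₄ ∘ x_S)`**.  Its defect of `T`
  (`Xhv_dT_apply`): **`𝔇(T)(I, J) = h₄(x_S I)·(Q′·G_v,toy·Q′*)(I, J) − (Q′·Gtoy·Q′*)(I, J)·h₄(x_S J)`**, i.e.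
  (`Xhv_dT_split`) `= h₄(x_S I)·(T₂ − T₁)(I, J) + (h₄(x_S I) − h₄(x_S J))·T₁(I, J)`: the cutoff times the
  GENUINE two-background difference (Toy12/13's object) plus Toy14's commutator.  The sequences DIFFER whenever
  `v ≢ 0` (`Xhv_G'₂_ne_G'₁`, `Xhv_A'₂_ne_A'₁`).
* §2 **CLASSES**: Toy14's five `h₄` coefficient classes lift from `θ_H` to `θ_H + t` (`opZon_thetaH_add`); the
  cutoff-weighted potential `diag(h₄·v) ∈ 𝒵(−2, t)` for a zone-supported `v` with `|h₄v| ≤ tB⁻²`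
  (`opZon_h4v`, Toy12's `opZon_diagonal_toy`); hence **`Ξ + diag(h₄v) ∈ 𝒵(−2, θ_H + t)`** (`h4v_zAm₀`); and the
  trivial bound `|h₄v| ≤ 3a²B⁻²` (`abs_h4_mul_v_le`).
* §3 **THE COMPLETE CUT MODEL `cutXhv`** over the toy frame of the ramp zone, for `supp v ⊆ rampZone` and
  `|h₄v| ≤ tB⁻²`: Toy14's `cutXh` field by field (cutoff `h₄`, `ω₀ = (3/2)(1/M)`, the seven h-free records
  `opLoc_Qp`/`opLoc_Qpt`/`opLoc_Dfw`/`opLoc_Dbw`/`opLoc_zero` — unchanged, since the sequence-2 members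
  `Q, Q*, ∂, ∂*, A = 0, Q′, Q′*` do not see the potential —, the agreement facts `rfl` for the same reason, the
  Leibniz block `Lm₁ = −(Θ+ΘS)`, `Lm₀ = Dm₀ = ΞSᵀ`, `Dm₁ = −Θ`, `Am₁ = Θ + SᵀΘ` as in Toy14), EXCEPT the
  multi-level slot: `𝔇(Δ′_a) = 𝔇(∂*∂ + μ) + 𝔇(A′) = (Θ + SᵀΘ)·∂ + Ξ + diag(h₄)·diag(v) − 0·diag(h₄)`, so
  **`Am₀ := Ξ + diag(h₄·v)`** at **`θL := θ_H + t`**.  `cutXhv_theta`: **`θ = θ_X + t`**; `ldatXhv := cutXhv.toLDat`.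
* §4 **THE `(M)` BUNDLES** `mOne_Xhv`, `mTwo_Xhv` at `c = 256a⁴` (Toy11's `mOne_of_seq1` route and the nine slots
  of `mTwo_Xpot` with `∇ := ∂*`: `mDvG := DbwGtoyv_opDec_num`).
* §5 **THEOREM D FOR `Xhv` ON THE DECAYING FRAME**: `estHypXhvD := assemble …` and the headline
  **`XhvD_dT_entry`**: `|𝔇(T)(I, J)| ≤ 22·(θ_X + t)·(256a⁴·1·Kg(δ₀/40))¹⁵·B²·exp(−(δ₀/4)(|I−J| + β(I) + β(J)))`
  (`β = zoneDepth` to the ramp zone); `XhvD_dT_entry_gen`: any zone-supported `v` with `t = 3a²` (covers Toy12's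
  zone potential `vzone` on the ramp zone).
* §6 **THE SHADOW POTENTIAL — THE PRINTED SITUATION** (two backgrounds that COINCIDE on the support of the cutoff
  and differ behind it): `vsh n B M I₀ a x = 3(a/B)²` on the sites of the ramp zone where `h₄ = 0`, `0` elsewhere;
  `h₄·vsh ≡ 0` (`h4_mul_vsh`) so `t = 0` and **every one of the sixteen (L) fields has constant `θ_X = O(M⁻¹)`**
  although the two sequences differ (`vsh (I₀, 0) ≠ 0`, `Xsh_G'₂_ne_G'₁`); `Xsh := Xhv … vsh …`; the headline
  **`XshD_dT_entry`**: `|h₄(x_S I)·(Q′G_v,toyQ′*)(I,J) − (Q′GtoyQ′*)(I,J)·h₄(x_S J)| ≤ 22·θ_X·(256a⁴·1·Kg(δ₀/40))¹⁵·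
  B²·exp(−(δ₀/4)(|I−J| + β(I) + β(J)))` and **`XshD_dT_entry_explicit`** (`22·(48/M)·(20736a⁴/δ₀)¹⁵`).

HONEST CAVEATS.  (1) The left side is not certified non-zero: `T₂ ≠ T₁` would need entrywise information on
`Q′·Gtoy·Q′*` between blocks which the cell has not typed; what IS certified is that the sequences differ
(`G′₂ ≠ G′₁`, `A′₂ ≠ A′₁`) and the exact formula `Xhv_dT_apply`.  (2) In the shadow instance the potential lives
on at most the `≈ 2B` sites of the ramp zone left of the ramp foot (blocks `I₀ − 1`, `I₀`), a thin layer: the point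
is structural (every hypothesis slot of THEOREM D inhabited with two different sequences, a genuine cutoff and
`θ = O(M⁻¹)`), not a strong-field comparison; for a potential overlapping `supp h₄` the honest constant is
`θ_X + 3a²` (`XhvD_dT_entry_gen`), no longer `O(M⁻¹)` — consistently with the text, where the two backgrounds are
gauge copies of each other on the support of `h`.  (3) The constant `(256a⁴·Kg(δ₀/40))¹⁵ ≤ (20736a⁴/δ₀)¹⁵` is
ASTRONOMICAL (the cell's monomial bookkeeping); the rate `δ₀/4` is the generic output rate.  (4) `∇ := ∂*` as in
Toy14 (forced by the Dirichlet/Neumann asymmetry of `Gtoy`).  (5) One-dimensional TOY (blocks `Fin n`, sites = bonds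
`Fin n × Fin B`, one level, constant proper scale `B`, windows = everything) — NOT summit progress; nothing here
bears on B9's Theorems 3.1–3.3 for the lattice gauge-field operators.  Value = kernel certificate that the cell's
THEOREM D record is inhabited IN THE PRINTED SHAPE — two different operator sequences, a genuine smooth cutoff on
whose support they agree, all 7 + 9 + 16 hypothesis slots genuine — with an `O(M⁻¹)`, volume-free constant.
-/

namespace Literature.MathematicalPhysics.QuantumFieldTheory.Balaban1983to89.B9SectCDiffCutModelToy15

open Finset Real
open B4Sect5Torus (IsPseudoDist)
open B6DomainChange (IsDepth Profile)
open B6DomainMajorant (zoneDepth isDepth_zoneDepth)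
open B9SectCDiffEstimate
open B9SectCDiffAssembly
open B9SectCDiffExpansion (TwoSeq)
open B9SectCDiffCutModel
open B9SectCDiffCutModelToy
open B9SectCDiffCutModelToy2
open B9SectCDiffCutModelToy3
open B9SectCDiffCutModelToy4
open B9SectCDiffCutModelToy5
open B9SectCDiffCutModelToy6
open B9SectCDiffCutModelToy7
open B9SectCDiffCutModelToy8
open B9SectCDiffCutModelToy9
open B9SectCDiffCutModelToy10
open B9SectCDiffCutModelToy11
open B9SectCDiffCutModelToy12
open B9SectCDiffCutModelToy13
open B9SectCDiffCutModelToy14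
open B9SectCDiff (tdef cutX)

noncomputable section

/-! ## §1 The datum `Xhv`: two different sequences and the smooth cutoff -/

section Datum

variable {n B M I₀ : ℕ} {δ₀ a : ℝ} {v : Fin n × Fin B → ℝ}

/-- **THE DATUM `Xhv`**: Toy11's potential datum `Xpot n B a v` (sequence 1 = Toy10's genuine toy operators,
sequence 2 = the same with the site potential `v` added to `Δ′_a`: `A′₂ = diag v`, `G′₂ = G_v`, `C₂ = E_v⁻¹`,
`G₂ = G_v,toy`; `μ = (a/B)²`, `2²⁴ ≤ a`, `2a ≤ B`, `0 ≤ v ≤ 3μ`) with Toy14's NON-TRIVIAL intertwiners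
`χs = χb = diag(h₄)` (Toy4's `C¹` ramp cutoff of width `M` blocks at block `I₀`) and `ψS = ψB = cutX id id
(h₄ ∘ x_S)`.  Two DIFFERENT sequences (`v ≢ 0`) AND a genuine cutoff.  OURS (typing). [folklore] -/
def Xhv (n B M I₀ : ℕ) (a : ℝ) (v : Fin n × Fin B → ℝ) (ha : 16777216 ≤ a) (haB : 2 * a ≤ (B : ℝ))
    (hv0 : ∀ x, 0 ≤ v x) (hv1 : ∀ x, v x ≤ 3 * (a / B) ^ 2) :
    TwoSeq (Fin n × Fin B) (Fin n × Fin B) (Fin n) (Fin n) (Fin n) (Fin n) :=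
  { Xpot n B a v ha haB hv0 hv1 with
    χs := Matrix.diagonal (h4 n B M I₀)
    χb := Matrix.diagonal (h4 n B M I₀)
    ψS := cutX id id fun I => h4 n B M I₀ (xS (hBnat_of ha haB) I)
    ψB := cutX id id fun I => h4 n B M I₀ (xS (hBnat_of ha haB) I) }

variable {ha : 16777216 ≤ a} {haB : 2 * a ≤ (B : ℝ)} {hv0 : ∀ x, 0 ≤ v x} {hv1 : ∀ x, v x ≤ 3 * (a / B) ^ 2}

/-- projection: `χs = diag(h₄)`. [folklore] -/
@[simp] theorem Xhv_χs : (Xhv n B M I₀ a v ha haB hv0 hv1).χs = Matrix.diagonal (h4 n B M I₀) := rfl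
/-- projection: `χb = diag(h₄)`. [folklore] -/
@[simp] theorem Xhv_χb : (Xhv n B M I₀ a v ha haB hv0 hv1).χb = Matrix.diagonal (h4 n B M I₀) := rfl
/-- projection: `ψS = cutX(h₄ ∘ x_S)`. [folklore] -/
@[simp] theorem Xhv_ψS :
    (Xhv n B M I₀ a v ha haB hv0 hv1).ψS = cutX id id fun I => h4 n B M I₀ (xS (hBnat_of ha haB) I) := rfl
/-- projection: `ψB = cutX(h₄ ∘ x_S)`. [folklore] -/
@[simp] theorem Xhv_ψB :
    (Xhv n B M I₀ a v ha haB hv0 hv1).ψB = cutX id id fun I => h4 n B M I₀ (xS (hBnat_of ha haB) I) := rfl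
/-- projection: `∂ = Dfw`. [folklore] -/
@[simp] theorem Xhv_D : (Xhv n B M I₀ a v ha haB hv0 hv1).D = Dfw n B := rfl
/-- projection: `∂* = Dbw`. [folklore] -/
@[simp] theorem Xhv_Dt : (Xhv n B M I₀ a v ha haB hv0 hv1).Dt = Dbw n B := rfl
/-- projection: `Λ = Lam(μ)`. [folklore] -/
@[simp] theorem Xhv_Λ : (Xhv n B M I₀ a v ha haB hv0 hv1).Λ = Lam n B ((a / B) ^ 2) := rfl
/-- projection: `Λ′ = μ·1`. [folklore] -/
@[simp] theorem Xhv_Λ' : (Xhv n B M I₀ a v ha haB hv0 hv1).Λ' =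
    ((a / B) ^ 2 : ℝ) • (1 : Matrix (Fin n × Fin B) (Fin n × Fin B) ℝ) := rfl
/-- projection: `Q₁ = Qp`. [folklore] -/
@[simp] theorem Xhv_Q₁ : (Xhv n B M I₀ a v ha haB hv0 hv1).Q₁ = Qp n B := rfl
/-- projection: `Q₂ = Qp`. [folklore] -/
@[simp] theorem Xhv_Q₂ : (Xhv n B M I₀ a v ha haB hv0 hv1).Q₂ = Qp n B := rfl
/-- projection: `Q*₁ = Qpt`. [folklore] -/
@[simp] theorem Xhv_Qt₁ : (Xhv n B M I₀ a v ha haB hv0 hv1).Qt₁ = Qpt n B := rfl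
/-- projection: `Q*₂ = Qpt`. [folklore] -/
@[simp] theorem Xhv_Qt₂ : (Xhv n B M I₀ a v ha haB hv0 hv1).Qt₂ = Qpt n B := rfl
/-- projection: `Q′₁ = Qp`. [folklore] -/
@[simp] theorem Xhv_Q'₁ : (Xhv n B M I₀ a v ha haB hv0 hv1).Q'₁ = Qp n B := rfl
/-- projection: `Q′₂ = Qp`. [folklore] -/
@[simp] theorem Xhv_Q'₂ : (Xhv n B M I₀ a v ha haB hv0 hv1).Q'₂ = Qp n B := rfl
/-- projection: `Q′*₁ = Qpt`. [folklore] -/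
@[simp] theorem Xhv_Q't₁ : (Xhv n B M I₀ a v ha haB hv0 hv1).Q't₁ = Qpt n B := rfl
/-- projection: `Q′*₂ = Qpt`. [folklore] -/
@[simp] theorem Xhv_Q't₂ : (Xhv n B M I₀ a v ha haB hv0 hv1).Q't₂ = Qpt n B := rfl
/-- projection: `A₁ = 0`. [folklore] -/
@[simp] theorem Xhv_A₁ : (Xhv n B M I₀ a v ha haB hv0 hv1).A₁ = 0 := rfl
/-- projection: `A₂ = 0`. [folklore] -/
@[simp] theorem Xhv_A₂ : (Xhv n B M I₀ a v ha haB hv0 hv1).A₂ = 0 := rfl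
/-- projection: `A′₁ = 0`. [folklore] -/
@[simp] theorem Xhv_A'₁ : (Xhv n B M I₀ a v ha haB hv0 hv1).A'₁ = 0 := rfl
/-- projection: `A′₂ = diag v` — the sequence-2 background. [folklore] -/
@[simp] theorem Xhv_A'₂ : (Xhv n B M I₀ a v ha haB hv0 hv1).A'₂ = Matrix.diagonal v := rfl
/-- projection: `G′₁ = G′(μ)`. [folklore] -/
@[simp] theorem Xhv_G'₁ : (Xhv n B M I₀ a v ha haB hv0 hv1).G'₁ = Gr n B ((a / B) ^ 2) := rfl
/-- projection: `G′₂ = G_v`. [folklore] -/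
@[simp] theorem Xhv_G'₂ : (Xhv n B M I₀ a v ha haB hv0 hv1).G'₂ = Gv n B ((a / B) ^ 2) v := rfl
/-- projection: `C₁ = E₂⁻¹`. [folklore] -/
@[simp] theorem Xhv_C₁ : (Xhv n B M I₀ a v ha haB hv0 hv1).C₁ = (E2 n B ((a / B) ^ 2))⁻¹ := rfl
/-- projection: `C₂ = E_v⁻¹`. [folklore] -/
@[simp] theorem Xhv_C₂ : (Xhv n B M I₀ a v ha haB hv0 hv1).C₂ = (Ev n B ((a / B) ^ 2) v)⁻¹ := rfl
/-- projection: `G₁ = Gtoy`. [folklore] -/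
@[simp] theorem Xhv_G₁ :
    (Xhv n B M I₀ a v ha haB hv0 hv1).G₁ = Gtoy n B ((a / B) ^ 2) ((a / B) ^ 2) := rfl
/-- projection: `G₂ = G_v,toy`. [folklore] -/
@[simp] theorem Xhv_G₂ :
    (Xhv n B M I₀ a v ha haB hv0 hv1).G₂ = Gtoyv n B ((a / B) ^ 2) ((a / B) ^ 2) v := rfl
/-- the coarse operator of sequence 1: `T₁ = Q′·Gtoy·Q′*`. [folklore] -/
theorem Xhv_T₁ : (Xhv n B M I₀ a v ha haB hv0 hv1).T₁ =
    Qp n B * Gtoy n B ((a / B) ^ 2) ((a / B) ^ 2) * Qpt n B := rfl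
/-- the coarse operator of sequence 2: `T₂ = Q′·G_v,toy·Q′*`. [folklore] -/
theorem Xhv_T₂ : (Xhv n B M I₀ a v ha haB hv0 hv1).T₂ =
    Qp n B * Gtoyv n B ((a / B) ^ 2) ((a / B) ^ 2) v * Qpt n B := rfl

/-- **THE DEFECT OF `T`**: `𝔇(T)(I, J) = h₄(x_S I)·(Q′·G_v,toy·Q′*)(I, J) − (Q′·Gtoy·Q′*)(I, J)·h₄(x_S J)` — a
smooth cutoff between two DIFFERENT coarse operators. [folklore] -/
theorem Xhv_dT_apply (I J : Fin n) :
    (Xhv n B M I₀ a v ha haB hv0 hv1).dT I J =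
      h4 n B M I₀ (xS (hBnat_of ha haB) I) * (Qp n B * Gtoyv n B ((a / B) ^ 2) ((a / B) ^ 2) v * Qpt n B) I J
        - (Qp n B * Gtoy n B ((a / B) ^ 2) ((a / B) ^ 2) * Qpt n B) I J * h4 n B M I₀ (xS (hBnat_of ha haB) J) := by
  show tdef (cutX id id fun I => h4 n B M I₀ (xS (hBnat_of ha haB) I))
      (cutX id id fun I => h4 n B M I₀ (xS (hBnat_of ha haB) I))
      (Qp n B * Gtoy n B ((a / B) ^ 2) ((a / B) ^ 2) * Qpt n B)
      (Qp n B * Gtoyv n B ((a / B) ^ 2) ((a / B) ^ 2) v * Qpt n B) I J = _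
  rw [cutX_id_id, B9SectCDiff.tdef_def, Matrix.sub_apply, Matrix.diagonal_mul, Matrix.mul_diagonal]

/-- **THE SPLIT**: `𝔇(T)(I, J) = h₄(x_S I)·(T₂ − T₁)(I, J) + (h₄(x_S I) − h₄(x_S J))·T₁(I, J)` — the cutoff times
the genuine two-background difference, plus Toy14's commutator term. [folklore] -/
theorem Xhv_dT_split (I J : Fin n) :
    (Xhv n B M I₀ a v ha haB hv0 hv1).dT I J =
      h4 n B M I₀ (xS (hBnat_of ha haB) I) *
          ((Qp n B * Gtoyv n B ((a / B) ^ 2) ((a / B) ^ 2) v * Qpt n B) I J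
            - (Qp n B * Gtoy n B ((a / B) ^ 2) ((a / B) ^ 2) * Qpt n B) I J)
        + (h4 n B M I₀ (xS (hBnat_of ha haB) I) - h4 n B M I₀ (xS (hBnat_of ha haB) J)) *
          (Qp n B * Gtoy n B ((a / B) ^ 2) ((a / B) ^ 2) * Qpt n B) I J := by
  rw [Xhv_dT_apply]; ring

/-- **THE SEQUENCES DIFFER in the scalar propagator** whenever `v ≢ 0`: `G′₂ = G_v ≠ G′ = G′₁` (Toy11's
`Gv_ne_Gr`). [folklore] -/
theorem Xhv_G'₂_ne_G'₁ {x₀ : Fin n × Fin B} (hx : v x₀ ≠ 0) :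
    (Xhv n B M I₀ a v ha haB hv0 hv1).G'₂ ≠ (Xhv n B M I₀ a v ha haB hv0 hv1).G'₁ := by
  rw [Xhv_G'₂, Xhv_G'₁]
  exact Gv_ne_Gr (muB_pos (ha20_of ha) (haB_of ha haB)) hv0 hx

/-- **THE SEQUENCES DIFFER in the multi-level slot** whenever `v ≢ 0`: `A′₂ = diag v ≠ 0 = A′₁`. [folklore] -/
theorem Xhv_A'₂_ne_A'₁ {x₀ : Fin n × Fin B} (hx : v x₀ ≠ 0) :
    (Xhv n B M I₀ a v ha haB hv0 hv1).A'₂ ≠ (Xhv n B M I₀ a v ha haB hv0 hv1).A'₁ := by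
  rw [Xhv_A'₂, Xhv_A'₁]
  intro h
  have h' := congrFun (congrFun h x₀) x₀
  rw [Matrix.diagonal_apply_eq, Matrix.zero_apply] at h'
  exact hx h'

end Datum

/-! ## §2 Classes: the lift `θ_H ↦ θ_H + t` and the cutoff-weighted potential -/

section Classes

variable {n B M I₀ : ℕ} {N : Finset (Fin n)} {hN : N.Nonempty} {δ₀ a : ℝ} {v : Fin n × Fin B → ℝ}
variable {U V : Type*} [DecidableEq V] {bu : Fin n × Fin B → U} {bv : Fin n × Fin B → V} {pU : U → Fin n}
  {pV : V → Fin n}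

/-- a class at Toy14's constant `θ_H` is one at `θ_H + t`, `t ≥ 0` (monotonicity of `𝒵(k, θ)` on the valid toy
frame). [folklore] -/
theorem opZon_thetaH_add (hB : 0 < B) (hδ₀ : 0 < δ₀) {k : ℤ} {t : ℝ} (ht : 0 ≤ t)
    {Z : Matrix (Fin n × Fin B) (Fin n × Fin B) ℝ} (h : OpZon (toyFrame n B N hN δ₀) bu bv pU pV k (thetaH M δ₀) Z) :
    OpZon (toyFrame n B N hN δ₀) bu bv pU pV k (thetaH M δ₀ + t) Z :=
  B9SectCDiffDict.opZon_mono (toyFrame_valid hB hN hδ₀) h thetaH_nonneg (le_add_of_nonneg_right ht)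

/-- the trivial proper-scale bound on the cutoff-weighted potential: `|h₄(x)v(x)| ≤ 3a²·B⁻²` (`0 ≤ h₄ ≤ 1`,
Toy12's `abs_v_le`). [folklore] -/
theorem abs_h4_mul_v_le (hv0 : ∀ x, 0 ≤ v x) (hv1 : ∀ x, v x ≤ 3 * (a / B) ^ 2) :
    ∀ x : Fin n × Fin B, |h4 n B M I₀ x * v x| ≤ 3 * a ^ 2 * (B : ℝ) ^ (-2 : ℤ) := by
  intro x
  rw [abs_mul, abs_of_nonneg (h4_nonneg x)]
  calc h4 n B M I₀ x * |v x| ≤ 1 * (3 * a ^ 2 * (B : ℝ) ^ (-2 : ℤ)) :=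
        mul_le_mul (h4_le_one x) (abs_v_le hv0 hv1 x) (abs_nonneg _) zero_le_one
    _ = 3 * a ^ 2 * (B : ℝ) ^ (-2 : ℤ) := one_mul _

/-- **the cutoff-weighted potential `diag(h₄·v) ∈ 𝒵(−2, t)`** for a zone-supported `v` (`v x ≠ 0 ⇒ x.1 ∈ N`) with
`|h₄v| ≤ t·B⁻²` (Toy12's `opZon_diagonal_toy`). [folklore] -/
theorem opZon_h4v (hB : 0 < B) (hδ₀ : 0 < δ₀) {t : ℝ} (ht : 0 ≤ t) (hbu : ∀ x, pU (bu x) = x.1)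
    (hbv : ∀ x, pV (bv x) = x.1) (hvN : ∀ x, v x ≠ 0 → x.1 ∈ N)
    (hhv : ∀ x, |h4 n B M I₀ x * v x| ≤ t * (B : ℝ) ^ (-2 : ℤ)) :
    OpZon (toyFrame n B N hN δ₀) bu bv pU pV (-2) t (Matrix.diagonal fun x => h4 n B M I₀ x * v x) :=
  opZon_diagonal_toy hB hδ₀ ht hbu hbv hhv fun x hx => hvN x (right_ne_zero_of_mul hx)

/-- **the multi-level coefficient `Am₀ = Ξ + diag(h₄·v) ∈ 𝒵(−2, θ_H + t)`** on the toy frame of the ramp zone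
(Toy14's `h4_zAm₀H` + `opZon_h4v`, `opZon_add`). OURS. [folklore] -/
theorem h4v_zAm₀ (hB : 0 < B) (hM : 0 < M) (hIM : I₀ + M < n) (hδ₀ : 0 < δ₀) {t : ℝ} (ht : 0 ≤ t)
    (hbu : ∀ x, pU (bu x) = x.1) (hbv : ∀ x, pV (bv x) = x.1) (hvN : ∀ x, v x ≠ 0 → x.1 ∈ rampZone n M I₀)
    (hhv : ∀ x, |h4 n B M I₀ x * v x| ≤ t * (B : ℝ) ^ (-2 : ℤ)) :
    OpZon (toyFrame n B (rampZone n M I₀) (rampZone_nonempty (lt_of_hIM hIM)) δ₀) bu bv pU pV (-2)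
      (thetaH M δ₀ + t) (Xi (h4 n B M I₀) + Matrix.diagonal fun x => h4 n B M I₀ x * v x) :=
  B9SectCDiffDict.opZon_add (h4_zAm₀H hB hM hIM hδ₀ hbu hbv) (opZon_h4v hB hδ₀ ht hbu hbv hvN hhv)

end Classes

/-! ## §3 The complete cut model of `Xhv` -/

section Cut

variable {n B M I₀ : ℕ} {δ₀ a t : ℝ} {v : Fin n × Fin B → ℝ}
variable {ha : 16777216 ≤ a} {haB : 2 * a ≤ (B : ℝ)} {hv0 : ∀ x, 0 ≤ v x} {hv1 : ∀ x, v x ≤ 3 * (a / B) ^ 2}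

/-- **THE COMPLETE CUT MODEL OF `Xhv`** over the toy frame of the ramp zone `rampZone n M I₀` (frame sites
`id`/`id`, block maps `Prod.fst` / `id`, `∇ = ∂* = Dbw`, positions `E = Fin n × Fin B`, identity windows), for a
potential supported in the ramp zone with `|h₄v| ≤ t·B⁻²`.  ALL 76 fields as in Toy14's `cutXh` (`h := h₄`,
`ω₀ = (3/2)(1/M)`, the seven h-free records of the potential-free sequence-2 members `Q, Q*, ∂, ∂*, A = 0, Q′, Q′*`,
agreement facts `rfl`, far facts vacuous, `Lm₁ = −(Θ + ΘS)`, `Lm₀ = Dm₀ = ΞSᵀ`, `Dm₁ = −Θ`, `Am₁ = Θ + SᵀΘ`),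
except **`Am₀ := Ξ + diag(h₄·v)`** (`𝔇(A′) = diag(h₄)·diag(v) − 0`) and **`θL := θ_H + t`**.  Hypotheses
`2²⁴ ≤ a`, `2a ≤ B`, `0 ≤ v ≤ 3(a/B)²`, `0 < M`, `I₀ + M < n`, `0 < δ₀`, `0 ≤ t`.  OURS. [folklore] -/
def cutXhv (hM : 0 < M) (hIM : I₀ + M < n) (hδ₀ : 0 < δ₀) (hvN : ∀ x, v x ≠ 0 → x.1 ∈ rampZone n M I₀)
    (ht0 : 0 ≤ t) (hhv : ∀ x, |h4 n B M I₀ x * v x| ≤ t * (B : ℝ) ^ (-2 : ℤ)) :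
    CutModel (toyFrame n B (rampZone n M I₀) (rampZone_nonempty (lt_of_hIM hIM)) δ₀)
      (Xhv n B M I₀ a v ha haB hv0 hv1) id id Prod.fst Prod.fst id id Prod.fst Prod.fst Prod.fst id id (Dbw n B)
      (Fin n × Fin B) (Fin n) (Fin n) where
  dE := dE n B
  h := h4 n B M I₀
  ℓ := fun _ => (B : ℝ)
  ω₀ := 3 / 2 * (1 / M)
  blk := Prod.fst
  xs := id
  xb := id
  xS₁ := xS (hBnat_of ha haB)
  xS₂ := xS (hBnat_of ha haB)
  xB₁ := xS (hBnat_of ha haB)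
  xB₂ := xS (hBnat_of ha haB)
  fS₁ := id
  fS₂ := id
  fB₁ := id
  fB₂ := id
  oQ := ⟨1, 1, 1⟩
  oQt := ⟨1, 1, 1⟩
  oD := ⟨1, 0, 2 * Real.exp δ₀⟩
  oDt := ⟨1, 0, 2 * Real.exp δ₀⟩
  oA := ⟨0, 0, 0⟩
  oQ' := ⟨1, 1, 1⟩
  oQ't := ⟨1, 1, 1⟩
  θL := thetaH M δ₀ + t
  Lm₁ := -(Th (h4 n B M I₀) + Th (h4 n B M I₀) * Sh n B)
  Lm₀ := Xi (h4 n B M I₀) * (Sh n B).transpose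
  Dm₁ := -Th (h4 n B M I₀)
  Dm₀ := Xi (h4 n B M I₀) * (Sh n B).transpose
  Am₁ := Th (h4 n B M I₀) + (Sh n B).transpose * Th (h4 n B M I₀)
  Am₀ := Xi (h4 n B M I₀) + Matrix.diagonal fun x => h4 n B M I₀ x * v x
  hω₀ := by positivity
  fS₁_inj := Function.injective_id
  fS₂_inj := Function.injective_id
  fB₁_inj := Function.injective_id
  fB₂_inj := Function.injective_id
  xfS _ := rfl
  xfB _ := rfl
  blk_s _ := rfl
  blk_b _ := rfl
  blk_S _ := rfl
  blk_B _ := rfl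
  hχs := rfl
  hχb := rfl
  hψS := rfl
  hψB := rfl
  modulus := h4_modulus (N := rampZone n M I₀) (hN := rampZone_nonempty (lt_of_hIM hIM)) (δ₀ := δ₀)
    (hBnat_of ha haB) hM _
  zone := h4_zone (δ₀ := δ₀) (hBnat_of ha haB) hM (rampZone_nonempty (lt_of_hIM hIM))
  farS₁ I hI := absurd ⟨I, rfl⟩ hI
  farS₂ J hJ := absurd ⟨J, rfl⟩ hJ
  farB₁ I hI := absurd ⟨I, rfl⟩ hI
  farB₂ J hJ := absurd ⟨J, rfl⟩ hJ
  agQ _ _ _ := rfl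
  agQt _ _ _ := rfl
  agA _ _ _ := rfl
  agQ' _ _ _ := rfl
  agQ't _ _ _ := rfl
  lQ := opLoc_toy (opLoc_Qp (hBnat_of ha haB))
  lQt := opLoc_toy (opLoc_Qpt (hBnat_of ha haB))
  lD := opLoc_toy (opLoc_Dfw (hBnat_of ha haB) hδ₀.le)
  lDt := opLoc_toy (opLoc_Dbw (hBnat_of ha haB) hδ₀.le)
  lA := opLoc_zero _ _ _ _ _ _ _ _ _ _ _ _
  lQ' := opLoc_toy (opLoc_Qp (hBnat_of ha haB))
  lQ't := opLoc_toy (opLoc_Qpt (hBnat_of ha haB))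
  locQ₁ := locQp1 (hBnat_of ha haB)
  locQ'₁ := locQp1 (hBnat_of ha haB)
  locQt₂ := locQpt2 (hBnat_of ha haB)
  locQ't₂ := locQpt2 (hBnat_of ha haB)
  hθL := add_nonneg thetaH_nonneg ht0
  hΛ := by
    show tdef (Matrix.diagonal (h4 n B M I₀)) (Matrix.diagonal (h4 n B M I₀)) (Lam n B ((a / B) ^ 2))
        (Lam n B ((a / B) ^ 2)) = _
    unfold Lam
    rw [B9SectCDiff.tdef_add, B9SectCDiff.tdef_smul, B9SectCDiff.tdef_one, smul_zero, zero_add]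
    exact dDDt_eq_bw _
  zLm₁ := opZon_thetaH_add (hBnat_of ha haB) hδ₀ ht0
    (h4_zLm₁bw (hBnat_of ha haB) hM hIM hδ₀ (fun _ => rfl) (fun _ => rfl))
  zLm₀ := opZon_thetaH_add (hBnat_of ha haB) hδ₀ ht0
    (h4_zXiSt (hBnat_of ha haB) hM hIM hδ₀ (fun _ => rfl) (fun _ => rfl))
  hM := D_mul_dDt_bw _
  zDm₁ := opZon_thetaH_add (hBnat_of ha haB) hδ₀ ht0
    (h4_zDm₁bw (hBnat_of ha haB) hM hIM hδ₀ (fun _ => rfl) (fun _ => rfl))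
  zDm₀ := opZon_thetaH_add (hBnat_of ha haB) hδ₀ ht0
    (h4_zXiSt (hBnat_of ha haB) hM hIM hδ₀ (fun _ => rfl) (fun _ => rfl))
  hA := by
    show tdef (Matrix.diagonal (h4 n B M I₀)) (Matrix.diagonal (h4 n B M I₀))
        (Dbw n B * Dfw n B + ((a / B) ^ 2 : ℝ) • (1 : Matrix (Fin n × Fin B) (Fin n × Fin B) ℝ) + 0)
        (Dbw n B * Dfw n B + ((a / B) ^ 2 : ℝ) • (1 : Matrix (Fin n × Fin B) (Fin n × Fin B) ℝ)
          + Matrix.diagonal v) =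
      (Th (h4 n B M I₀) + (Sh n B).transpose * Th (h4 n B M I₀)) * Dfw n B
        + (Xi (h4 n B M I₀) + Matrix.diagonal fun x => h4 n B M I₀ x * v x)
    rw [B9SectCDiff.tdef_add, (leibniz_affine (h4 n B M I₀) 0 0 ((a / B) ^ 2)).2.2, B9SectCDiff.tdef_def,
      Matrix.zero_mul, sub_zero, Matrix.diagonal_mul_diagonal, add_assoc]
  zAm₁ := opZon_thetaH_add (hBnat_of ha haB) hδ₀ ht0
    (h4_zAm₁H (hBnat_of ha haB) hM hIM hδ₀ (fun _ => rfl) (fun _ => rfl))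
  zAm₀ := h4v_zAm₀ (hBnat_of ha haB) hM hIM hδ₀ ht0 (fun _ => rfl) (fun _ => rfl) hvN hhv

/-- **the common (L) constant of `cutXhv` is `θ_X + t`** (`ω₀·Σ r_T c_T` as in Toy14, `θL = θ_H + t`). OURS.
[folklore] -/
theorem cutXhv_theta (hM : 0 < M) (hIM : I₀ + M < n) (hδ₀ : 0 < δ₀)
    (hvN : ∀ x, v x ≠ 0 → x.1 ∈ rampZone n M I₀) (ht0 : 0 ≤ t)
    (hhv : ∀ x, |h4 n B M I₀ x * v x| ≤ t * (B : ℝ) ^ (-2 : ℤ)) :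
    (cutXhv (ha := ha) (haB := haB) (hv0 := hv0) (hv1 := hv1) hM hIM hδ₀ hvN ht0 hhv).theta
      = thetaX M δ₀ + t := by
  show 3 / 2 * (1 / (M : ℝ)) * (1 * 1 + 1 * 1 + 1 * (2 * Real.exp δ₀) + 1 * (2 * Real.exp δ₀) + 0 * 0 + 1 * 1
    + 1 * 1) + (thetaH M δ₀ + t) = thetaX M δ₀ + t
  unfold thetaH thetaX
  ring

/-- record: the cutoff of `cutXhv` is `h₄`. [folklore] -/
@[simp] theorem cutXhv_h (hM : 0 < M) (hIM : I₀ + M < n) (hδ₀ : 0 < δ₀)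
    (hvN : ∀ x, v x ≠ 0 → x.1 ∈ rampZone n M I₀) (ht0 : 0 ≤ t)
    (hhv : ∀ x, |h4 n B M I₀ x * v x| ≤ t * (B : ℝ) ^ (-2 : ℤ)) :
    (cutXhv (ha := ha) (haB := haB) (hv0 := hv0) (hv1 := hv1) hM hIM hδ₀ hvN ht0 hhv).h = h4 n B M I₀ := rfl

/-- record: the Leibniz constant of `cutXhv` is `θ_H + t`. [folklore] -/
@[simp] theorem cutXhv_θL (hM : 0 < M) (hIM : I₀ + M < n) (hδ₀ : 0 < δ₀)
    (hvN : ∀ x, v x ≠ 0 → x.1 ∈ rampZone n M I₀) (ht0 : 0 ≤ t)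
    (hhv : ∀ x, |h4 n B M I₀ x * v x| ≤ t * (B : ℝ) ^ (-2 : ℤ)) :
    (cutXhv (ha := ha) (haB := haB) (hv0 := hv0) (hv1 := hv1) hM hIM hδ₀ hvN ht0 hhv).θL = thetaH M δ₀ + t :=
  rfl

/-- record: the multi-level coefficient of `cutXhv` is `Ξ + diag(h₄·v)`. [folklore] -/
@[simp] theorem cutXhv_Am₀ (hM : 0 < M) (hIM : I₀ + M < n) (hδ₀ : 0 < δ₀)
    (hvN : ∀ x, v x ≠ 0 → x.1 ∈ rampZone n M I₀) (ht0 : 0 ≤ t)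
    (hhv : ∀ x, |h4 n B M I₀ x * v x| ≤ t * (B : ℝ) ^ (-2 : ℤ)) :
    (cutXhv (ha := ha) (haB := haB) (hv0 := hv0) (hv1 := hv1) hM hIM hδ₀ hvN ht0 hhv).Am₀
      = Xi (h4 n B M I₀) + Matrix.diagonal fun x => h4 n B M I₀ x * v x := rfl

/-- **THE `(L)` BUNDLE OF `Xhv`**: THEOREM D's sixteen (L) fields on the toy frame of the ramp zone at
`θ = cutXhv.theta = θ_X + t`, by the cell's `CutModel.toLDat`. OURS. [folklore] -/
def ldatXhv (hM : 0 < M) (hIM : I₀ + M < n) (hδ₀ : 0 < δ₀) (hvN : ∀ x, v x ≠ 0 → x.1 ∈ rampZone n M I₀)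
    (ht0 : 0 ≤ t) (hhv : ∀ x, |h4 n B M I₀ x * v x| ≤ t * (B : ℝ) ^ (-2 : ℤ)) :
    LDat (toyFrame n B (rampZone n M I₀) (rampZone_nonempty (lt_of_hIM hIM)) δ₀)
      (Xhv n B M I₀ a v ha haB hv0 hv1) id id Prod.fst Prod.fst id id Prod.fst Prod.fst Prod.fst id id (Dbw n B)
      (cutXhv (ha := ha) (haB := haB) (hv0 := hv0) (hv1 := hv1) hM hIM hδ₀ hvN ht0 hhv).theta :=
  (cutXhv hM hIM hδ₀ hvN ht0 hhv).toLDat (toyFrame_valid (hBnat_of ha haB) _ hδ₀)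

end Cut

/-! ## §4 The `(M)` bundles of `Xhv` at `c = 256a⁴` -/

section MBundles

variable {n B M I₀ : ℕ} {N : Finset (Fin n)} {hN : N.Nonempty} {δ₀ a : ℝ} {v : Fin n × Fin B → ℝ}
variable {ha : 16777216 ≤ a} {haB : 2 * a ≤ (B : ℝ)} {hv0 : ∀ x, 0 ≤ v x} {hv1 : ∀ x, v x ≤ 3 * (a / B) ^ 2}

/-- **(M) OF SEQUENCE 1 for `Xhv` at `c = 256a⁴`** (Toy10's parametric `mOne_of_seq1` at `3a⁴`, enlarged by
Toy11's `mOne_toy_mono`; the (M) classes do not see the intertwiners). [folklore] -/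
theorem mOne_Xhv (hδ : δ₀ ≤ 1 / 2) :
    MOne (toyFrame n B N hN δ₀) (Xhv n B M I₀ a v ha haB hv0 hv1) id Prod.fst Prod.fst id id (256 * a ^ 4) := by
  have ha0 : 0 < a := by linarith
  obtain ⟨-, h3, -⟩ := bundle_consts_v ha
  exact mOne_toy_mono (mOne_of_seq1 (Xhv n B M I₀ a v ha haB hv0 hv1) rfl rfl rfl rfl rfl rfl rfl (ha20_of ha)
    (haB_of ha haB) hδ) (by positivity) h3

/-- **(M) OF SEQUENCE 2 for `Xhv` at `c = 256a⁴` WITH `∇ := ∂*`**: the nine slots of `MTwo` as in Toy11's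
`mTwo_Xpot` (`Gtoyv_opDec_num`, `opDec_Qpt`, `DbwGtoyv_opDec_num`, `Gv_opDec_num`, `DGv_opDec_num`,
`Ev_inv_opDec_num`, `opDec_of_rowsum`), except `mDvG := DbwGtoyv_opDec_num` (genuine `∂*·G_v,toy`). [folklore] -/
theorem mTwo_Xhv (hδ : δ₀ ≤ 1 / 2) :
    MTwo (toyFrame n B N hN δ₀) (Xhv n B M I₀ a v ha haB hv0 hv1) id Prod.fst Prod.fst Prod.fst id id (Dbw n B)
      (256 * a ^ 4) := by
  have ha0 : 0 < a := by linarith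
  have hB : 0 < B := hBnat_of ha haB
  obtain ⟨h1, -, hcC, hcG, hcDt, hcD, hcGr⟩ := bundle_consts_v ha
  exact
    { mG := opDec_toy_mono (Gtoyv_opDec_num ha haB hv0 hv1 hδ) (by positivity) hcG
      mQt := opDec_Qpt h1
      mDtG := opDec_toy_mono (DbwGtoyv_opDec_num ha haB hv0 hv1 hδ) (by positivity) hcDt
      mDvG := opDec_toy_mono (DbwGtoyv_opDec_num ha haB hv0 hv1 hδ) (by positivity) hcDt
      mG' := opDec_toy_mono (Gv_opDec_num (by linarith) (haB_of ha haB) hv0 hδ) (by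
          have : 0 < a - 1 := by linarith
          positivity) hcGr
      mDG' := opDec_toy_mono (DGv_opDec_num (ha20_of ha) (haB_of ha haB) hv0 hv1 hδ) (by positivity) hcD
      mQ't := opDec_Qpt h1
      mC := opDec_toy_mono (Ev_inv_opDec_num ha haB hv0 hv1 hδ) (by positivity) hcC
      mQ' := opDec_of_rowsum (Qp_rowsum hB) h1 }

end MBundles

/-! ## §5 THEOREM D for `Xhv` on the decaying frame -/

section EstD

variable {n B M I₀ : ℕ} {δ₀ a t : ℝ} {v : Fin n × Fin B → ℝ}
variable {ha : 16777216 ≤ a} {haB : 2 * a ≤ (B : ℝ)} {hv0 : ∀ x, 0 ≤ v x} {hv1 : ∀ x, v x ≤ 3 * (a / B) ^ 2}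

/-- **`EstHyp` FOR `Xhv` ON THE DECAYING FRAME**: §4's bundles (`c = 256a⁴`) and §3's `ldatXhv` (`θ = θ_X + t`)
transported to Toy13's `toyFrameD`, the volume-free profile for both block families, assembled by the cell's
`assemble`; hypotheses `2²⁴ ≤ a`, `2a ≤ B`, `0 ≤ v ≤ 3(a/B)²` supported in the ramp zone, `|h₄v| ≤ tB⁻²`,
`0 < M`, `I₀ + M < n`, `0 < δ₀ ≤ 1/2`.  OURS. [folklore] -/
def estHypXhvD (hM : 0 < M) (hIM : I₀ + M < n) (hδ₀ : 0 < δ₀) (hδ : δ₀ ≤ 1 / 2)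
    (hvN : ∀ x, v x ≠ 0 → x.1 ∈ rampZone n M I₀) (ht0 : 0 ≤ t)
    (hhv : ∀ x, |h4 n B M I₀ x * v x| ≤ t * (B : ℝ) ^ (-2 : ℤ)) :
    EstHyp (toyFrameD n B (rampZone n M I₀) (rampZone_nonempty (lt_of_hIM hIM)) δ₀)
      (Xhv n B M I₀ a v ha haB hv0 hv1) (Fin n × Fin B) (Fin n) (Fin n) :=
  assemble (toyFrameD_valid (hBnat_of ha haB) _ hδ₀) (mOne_toyD (mOne_Xhv hδ)) (mTwo_toyD (mTwo_Xhv hδ))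
    (ldatToyD (ldatXhv hM hIM hδ₀ hvN ht0 hhv)) (by positivity) (by positivity)
    (cutXhv hM hIM hδ₀ hvN ht0 hhv).theta_nonneg toyFrameD_profile₁ toyFrameD_profile₁

/-- the assembled (M) constant is `max(1, 256a⁴, 256a⁴) = 256a⁴`. [folklore] -/
theorem estHypXhvD_c (hM : 0 < M) (hIM : I₀ + M < n) (hδ₀ : 0 < δ₀) (hδ : δ₀ ≤ 1 / 2)
    (hvN : ∀ x, v x ≠ 0 → x.1 ∈ rampZone n M I₀) (ht0 : 0 ≤ t)
    (hhv : ∀ x, |h4 n B M I₀ x * v x| ≤ t * (B : ℝ) ^ (-2 : ℤ)) :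
    (estHypXhvD (ha := ha) (haB := haB) (hv0 := hv0) (hv1 := hv1) hM hIM hδ₀ hδ hvN ht0 hhv).c = 256 * a ^ 4 := by
  show max 1 (max (256 * a ^ 4) (256 * a ^ 4)) = 256 * a ^ 4
  rw [max_self, max_eq_right (one_le_c ha)]

/-- the assembled (L) constant is `θ_X + t`. [folklore] -/
theorem estHypXhvD_θ (hM : 0 < M) (hIM : I₀ + M < n) (hδ₀ : 0 < δ₀) (hδ : δ₀ ≤ 1 / 2)
    (hvN : ∀ x, v x ≠ 0 → x.1 ∈ rampZone n M I₀) (ht0 : 0 ≤ t)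
    (hhv : ∀ x, |h4 n B M I₀ x * v x| ≤ t * (B : ℝ) ^ (-2 : ℤ)) :
    (estHypXhvD (ha := ha) (haB := haB) (hv0 := hv0) (hv1 := hv1) hM hIM hδ₀ hδ hvN ht0 hhv).θ
      = thetaX M δ₀ + t :=
  cutXhv_theta hM hIM hδ₀ hvN ht0 hhv

/-- record: `p₁ = id`. [folklore] -/
theorem estHypXhvD_p₁ (hM : 0 < M) (hIM : I₀ + M < n) (hδ₀ : 0 < δ₀) (hδ : δ₀ ≤ 1 / 2)
    (hvN : ∀ x, v x ≠ 0 → x.1 ∈ rampZone n M I₀) (ht0 : 0 ≤ t)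
    (hhv : ∀ x, |h4 n B M I₀ x * v x| ≤ t * (B : ℝ) ^ (-2 : ℤ)) :
    (estHypXhvD (ha := ha) (haB := haB) (hv0 := hv0) (hv1 := hv1) hM hIM hδ₀ hδ hvN ht0 hhv).p₁ = id := rfl

/-- record: `p₂ = id`. [folklore] -/
theorem estHypXhvD_p₂ (hM : 0 < M) (hIM : I₀ + M < n) (hδ₀ : 0 < δ₀) (hδ : δ₀ ≤ 1 / 2)
    (hvN : ∀ x, v x ≠ 0 → x.1 ∈ rampZone n M I₀) (ht0 : 0 ≤ t)
    (hhv : ∀ x, |h4 n B M I₀ x * v x| ≤ t * (B : ℝ) ^ (-2 : ℤ)) :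
    (estHypXhvD (ha := ha) (haB := haB) (hv0 := hv0) (hv1 := hv1) hM hIM hδ₀ hδ hvN ht0 hhv).p₂ = id := rfl

/-- record: `bB₁ = id`. [folklore] -/
theorem estHypXhvD_bB₁ (hM : 0 < M) (hIM : I₀ + M < n) (hδ₀ : 0 < δ₀) (hδ : δ₀ ≤ 1 / 2)
    (hvN : ∀ x, v x ≠ 0 → x.1 ∈ rampZone n M I₀) (ht0 : 0 ≤ t)
    (hhv : ∀ x, |h4 n B M I₀ x * v x| ≤ t * (B : ℝ) ^ (-2 : ℤ)) :
    (estHypXhvD (ha := ha) (haB := haB) (hv0 := hv0) (hv1 := hv1) hM hIM hδ₀ hδ hvN ht0 hhv).bB₁ = id := rfl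

/-- record: `bB₂ = id`. [folklore] -/
theorem estHypXhvD_bB₂ (hM : 0 < M) (hIM : I₀ + M < n) (hδ₀ : 0 < δ₀) (hδ : δ₀ ≤ 1 / 2)
    (hvN : ∀ x, v x ≠ 0 → x.1 ∈ rampZone n M I₀) (ht0 : 0 ≤ t)
    (hhv : ∀ x, |h4 n B M I₀ x * v x| ≤ t * (B : ℝ) ^ (-2 : ℤ)) :
    (estHypXhvD (ha := ha) (haB := haB) (hv0 := hv0) (hv1 := hv1) hM hIM hδ₀ hδ hvN ht0 hhv).bB₂ = id := rfl

/-- non-vacuity record: the hypothesis record of THEOREM D is inhabited for `Xhv`. [folklore] -/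
theorem estHypXhvD_nonempty (hM : 0 < M) (hIM : I₀ + M < n) (hδ₀ : 0 < δ₀) (hδ : δ₀ ≤ 1 / 2)
    (hvN : ∀ x, v x ≠ 0 → x.1 ∈ rampZone n M I₀) (ht0 : 0 ≤ t)
    (hhv : ∀ x, |h4 n B M I₀ x * v x| ≤ t * (B : ℝ) ^ (-2 : ℤ)) :
    Nonempty (EstHyp (toyFrameD n B (rampZone n M I₀) (rampZone_nonempty (lt_of_hIM hIM)) δ₀)
      (Xhv n B M I₀ a v ha haB hv0 hv1) (Fin n × Fin B) (Fin n) (Fin n)) :=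
  ⟨estHypXhvD hM hIM hδ₀ hδ hvN ht0 hhv⟩

/-- **THEOREM D FOR `Xhv` ON THE DECAYING FRAME** (headline, parametric in the potential): the cell's
`EstHyp.dT_entry` on `estHypXhvD` with every frame field unfolded —
`|𝔇(T)(I, J)| ≤ 22·(θ_X + t)·(256a⁴·1·Kg(δ₀/40))¹⁵·B²·exp(−(δ₀/4)·(|I−J| + β(I) + β(J)))`, `β = zoneDepth` to the
ramp zone; `𝔇(T) = diag(h₄∘x_S)·(Q′G_v,toyQ′*) − (Q′GtoyQ′*)·diag(h₄∘x_S)` (`Xhv_dT_apply`).  Hypotheses: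
`2²⁴ ≤ a`, `2a ≤ B`, `0 ≤ v ≤ 3(a/B)²`, `supp v ⊆ rampZone`, `|h₄v| ≤ tB⁻²`, `0 < M`, `I₀ + M < n`,
`0 < δ₀ ≤ 1/2`.  OURS. [folklore] -/
theorem XhvD_dT_entry (hM : 0 < M) (hIM : I₀ + M < n) (hδ₀ : 0 < δ₀) (hδ : δ₀ ≤ 1 / 2)
    (hvN : ∀ x, v x ≠ 0 → x.1 ∈ rampZone n M I₀) (ht0 : 0 ≤ t)
    (hhv : ∀ x, |h4 n B M I₀ x * v x| ≤ t * (B : ℝ) ^ (-2 : ℤ)) (I J : Fin n) :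
    |(Xhv n B M I₀ a v ha haB hv0 hv1).dT I J| ≤
      22 * (thetaX M δ₀ + t) * (256 * a ^ 4 * 1 * Kg (δ₀ / 40)) ^ 15 * (B : ℝ) ^ (2 : ℤ) *
        Real.exp (-(δ₀ / 4 * (bdist n I J
          + zoneDepth (bdist n) (rampZone n M I₀) (rampZone_nonempty (lt_of_hIM hIM)) I
          + zoneDepth (bdist n) (rampZone n M I₀) (rampZone_nonempty (lt_of_hIM hIM)) J))) := by
  have h := (estHypXhvD (ha := ha) (haB := haB) (hv0 := hv0) (hv1 := hv1) hM hIM hδ₀ hδ hvN ht0 hhv).dT_entry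
    (toyFrameD_valid (hBnat_of ha haB) _ hδ₀) I J
  rw [toyFrameD_σ, estHypXhvD_c, estHypXhvD_θ, estHypXhvD_p₁, estHypXhvD_p₂, estHypXhvD_bB₁, estHypXhvD_bB₂,
    toyFrameD_Λ, toyFrameD_K, toyFrameD_u, toyFrameD_sc, toyFrameD_ρ, toyFrameD_β] at h
  exact h

/-- the headline with `𝔇(T)` written out: `|h₄(x_S I)·(Q′G_v,toyQ′*)(I, J) − (Q′GtoyQ′*)(I, J)·h₄(x_S J)| ≤ …`.
OURS. [folklore] -/
theorem XhvD_dT_entry_apply (hv0 : ∀ x, 0 ≤ v x) (hv1 : ∀ x, v x ≤ 3 * (a / B) ^ 2) (hM : 0 < M)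
    (hIM : I₀ + M < n) (hδ₀ : 0 < δ₀) (hδ : δ₀ ≤ 1 / 2) (hvN : ∀ x, v x ≠ 0 → x.1 ∈ rampZone n M I₀) (ht0 : 0 ≤ t)
    (hhv : ∀ x, |h4 n B M I₀ x * v x| ≤ t * (B : ℝ) ^ (-2 : ℤ)) (I J : Fin n) :
    |h4 n B M I₀ (xS (hBnat_of ha haB) I) * (Qp n B * Gtoyv n B ((a / B) ^ 2) ((a / B) ^ 2) v * Qpt n B) I J
        - (Qp n B * Gtoy n B ((a / B) ^ 2) ((a / B) ^ 2) * Qpt n B) I J * h4 n B M I₀ (xS (hBnat_of ha haB) J)|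
      ≤ 22 * (thetaX M δ₀ + t) * (256 * a ^ 4 * 1 * Kg (δ₀ / 40)) ^ 15 * (B : ℝ) ^ (2 : ℤ) *
        Real.exp (-(δ₀ / 4 * (bdist n I J
          + zoneDepth (bdist n) (rampZone n M I₀) (rampZone_nonempty (lt_of_hIM hIM)) I
          + zoneDepth (bdist n) (rampZone n M I₀) (rampZone_nonempty (lt_of_hIM hIM)) J))) := by
  rw [← Xhv_dT_apply (ha := ha) (haB := haB) (hv0 := hv0) (hv1 := hv1)]
  exact XhvD_dT_entry hM hIM hδ₀ hδ hvN ht0 hhv I J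

/-- **ANY ZONE-SUPPORTED POTENTIAL, `t = 3a²`**: `|𝔇(T)(I, J)| ≤ 22·(θ_X + 3a²)·(256a⁴·1·Kg(δ₀/40))¹⁵·B²·exp(…)`
(`abs_h4_mul_v_le`; covers Toy12's `vzone n B (3(a/B)²) (rampZone n M I₀)`).  The constant is no longer `O(M⁻¹)`:
a potential overlapping the support of the cutoff is SEEN by the cutoff (caveat (2)). OURS. [folklore] -/
theorem XhvD_dT_entry_gen (hM : 0 < M) (hIM : I₀ + M < n) (hδ₀ : 0 < δ₀) (hδ : δ₀ ≤ 1 / 2)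
    (hvN : ∀ x, v x ≠ 0 → x.1 ∈ rampZone n M I₀) (I J : Fin n) :
    |(Xhv n B M I₀ a v ha haB hv0 hv1).dT I J| ≤
      22 * (thetaX M δ₀ + 3 * a ^ 2) * (256 * a ^ 4 * 1 * Kg (δ₀ / 40)) ^ 15 * (B : ℝ) ^ (2 : ℤ) *
        Real.exp (-(δ₀ / 4 * (bdist n I J
          + zoneDepth (bdist n) (rampZone n M I₀) (rampZone_nonempty (lt_of_hIM hIM)) I
          + zoneDepth (bdist n) (rampZone n M I₀) (rampZone_nonempty (lt_of_hIM hIM)) J))) :=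
  XhvD_dT_entry hM hIM hδ₀ hδ hvN (by positivity) (abs_h4_mul_v_le hv0 hv1) I J

end EstD

/-! ## §6 The shadow potential: two backgrounds that agree on the support of the cutoff -/

section Shadow

variable {n B M I₀ : ℕ} {δ₀ a : ℝ}

/-- **THE SHADOW POTENTIAL**: height `3(a/B)²` on the sites of the ramp zone where the cutoff `h₄` VANISHES (the
`≈ 2B` sites of blocks `I₀ − 1`, `I₀` left of the ramp foot), `0` elsewhere — a second background that coincides
with the first on `supp h₄`. OURS (typing). [folklore] -/
def vsh (n B M I₀ : ℕ) (a : ℝ) (x : Fin n × Fin B) : ℝ :=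
  if x.1 ∈ rampZone n M I₀ ∧ h4 n B M I₀ x = 0 then 3 * (a / B) ^ 2 else 0

/-- `0 ≤ vsh`. [folklore] -/
theorem vsh_nonneg : ∀ x : Fin n × Fin B, 0 ≤ vsh n B M I₀ a x := fun x => by
  unfold vsh; split_ifs <;> positivity

/-- `vsh ≤ 3(a/B)²`. [folklore] -/
theorem vsh_le : ∀ x : Fin n × Fin B, vsh n B M I₀ a x ≤ 3 * (a / B) ^ 2 := fun x => by
  unfold vsh; split_ifs
  · exact le_rfl
  · positivity

/-- the shadow potential is supported in the ramp zone. [folklore] -/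
theorem mem_of_vsh_ne_zero : ∀ x : Fin n × Fin B, vsh n B M I₀ a x ≠ 0 → x.1 ∈ rampZone n M I₀ := by
  intro x hx
  unfold vsh at hx
  by_contra h
  exact hx (if_neg fun h' => h h'.1)

/-- the shadow potential vanishes on the support of the cutoff. [folklore] -/
theorem vsh_eq_zero_of_h4_ne_zero {x : Fin n × Fin B} (hx : h4 n B M I₀ x ≠ 0) : vsh n B M I₀ a x = 0 := by
  unfold vsh
  exact if_neg fun h' => hx h'.2

/-- **the two backgrounds agree on `supp h₄`**: `h₄·vsh ≡ 0`. [folklore] -/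
theorem h4_mul_vsh : ∀ x : Fin n × Fin B, h4 n B M I₀ x * vsh n B M I₀ a x = 0 := by
  intro x
  by_cases hx : h4 n B M I₀ x = 0
  · rw [hx, zero_mul]
  · rw [vsh_eq_zero_of_h4_ne_zero hx, mul_zero]

/-- the cutoff-weighted shadow potential in the `hhv` shape with `t = 0`. [folklore] -/
theorem abs_h4_mul_vsh_le : ∀ x : Fin n × Fin B, |h4 n B M I₀ x * vsh n B M I₀ a x| ≤ 0 * (B : ℝ) ^ (-2 : ℤ) :=
  fun x => by rw [h4_mul_vsh, abs_zero, zero_mul]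

/-- the cutoff vanishes at the base site `(I₀, 0)` of block `I₀` (position `I₀·B`, the foot of the ramp).
[folklore] -/
theorem h4_base (hB : 0 < B) (hM : 0 < M) (hI₀ : I₀ < n) :
    h4 n B M I₀ ((⟨I₀, hI₀⟩ : Fin n), (⟨0, hB⟩ : Fin B)) = 0 := by
  have hι : ((ι (((⟨I₀, hI₀⟩ : Fin n), (⟨0, hB⟩ : Fin B))) : ℕ) : ℝ) = (I₀ : ℝ) * B := by
    rw [ι_eq]; push_cast; ring
  rw [h4_eq, ramp_eq_zero_of_le hB hM hι.le, sstep_zero]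

/-- **the shadow potential is NOT identically zero**: it is `3(a/B)² ≠ 0` at the base site of block `I₀` (`0 < a`,
`0 < B`, `0 < M`, `I₀ < n`). [folklore] -/
theorem vsh_base_ne_zero (hB : 0 < B) (hM : 0 < M) (hI₀ : I₀ < n) (ha0 : 0 < a) :
    vsh n B M I₀ a ((⟨I₀, hI₀⟩ : Fin n), (⟨0, hB⟩ : Fin B)) ≠ 0 := by
  have hBr : (0 : ℝ) < B := by exact_mod_cast hB
  have hmem : (((⟨I₀, hI₀⟩ : Fin n), (⟨0, hB⟩ : Fin B)) : Fin n × Fin B).1 ∈ rampZone n M I₀ :=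
    mem_rampZone.2 ⟨Nat.le_succ _, Nat.le_add_right _ _⟩
  have h : vsh n B M I₀ a ((⟨I₀, hI₀⟩ : Fin n), (⟨0, hB⟩ : Fin B)) = 3 * (a / B) ^ 2 :=
    if_pos (And.intro hmem (h4_base hB hM hI₀))
  rw [h]
  positivity

variable {ha : 16777216 ≤ a} {haB : 2 * a ≤ (B : ℝ)}

/-- **THE SHADOW DATUM** `Xsh := Xhv … vsh …`: sequence 2 carries the shadow potential; the two backgrounds agree on
`supp h₄` and differ behind the ramp foot. OURS (typing). [folklore] -/
def Xsh (n B M I₀ : ℕ) (a : ℝ) (ha : 16777216 ≤ a) (haB : 2 * a ≤ (B : ℝ)) :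
    TwoSeq (Fin n × Fin B) (Fin n × Fin B) (Fin n) (Fin n) (Fin n) (Fin n) :=
  Xhv n B M I₀ a (vsh n B M I₀ a) ha haB vsh_nonneg vsh_le

/-- **THE SEQUENCES OF THE SHADOW DATUM DIFFER**: `G′₂ = G_vsh ≠ G′ = G′₁` (`0 < M`, `I₀ < n`). [folklore] -/
theorem Xsh_G'₂_ne_G'₁ (hM : 0 < M) (hI₀ : I₀ < n) :
    (Xsh n B M I₀ a ha haB).G'₂ ≠ (Xsh n B M I₀ a ha haB).G'₁ :=
  Xhv_G'₂_ne_G'₁ (vsh_base_ne_zero (hBnat_of ha haB) hM hI₀ (by linarith))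

/-- `A′₂ = diag vsh ≠ 0 = A′₁` for the shadow datum. [folklore] -/
theorem Xsh_A'₂_ne_A'₁ (hM : 0 < M) (hI₀ : I₀ < n) :
    (Xsh n B M I₀ a ha haB).A'₂ ≠ (Xsh n B M I₀ a ha haB).A'₁ :=
  Xhv_A'₂_ne_A'₁ (vsh_base_ne_zero (hBnat_of ha haB) hM hI₀ (by linarith))

/-- the defect of `T` of the shadow datum: `h₄(x_S I)·(Q′G_vsh,toyQ′*)(I, J) − (Q′GtoyQ′*)(I, J)·h₄(x_S J)`.
[folklore] -/
theorem Xsh_dT_apply (I J : Fin n) :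
    (Xsh n B M I₀ a ha haB).dT I J =
      h4 n B M I₀ (xS (hBnat_of ha haB) I) *
          (Qp n B * Gtoyv n B ((a / B) ^ 2) ((a / B) ^ 2) (vsh n B M I₀ a) * Qpt n B) I J
        - (Qp n B * Gtoy n B ((a / B) ^ 2) ((a / B) ^ 2) * Qpt n B) I J * h4 n B M I₀ (xS (hBnat_of ha haB) J) :=
  Xhv_dT_apply I J

/-- **the common (L) constant of the shadow datum is `θ_X = O(M⁻¹)`** (`t = 0`): every one of the sixteen (L)
fields at Toy14's constant although the sequences differ. OURS. [folklore] -/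
theorem cutXsh_theta (hM : 0 < M) (hIM : I₀ + M < n) (hδ₀ : 0 < δ₀) :
    (cutXhv (ha := ha) (haB := haB) (hv0 := vsh_nonneg) (hv1 := vsh_le) hM hIM hδ₀
        (mem_of_vsh_ne_zero (a := a)) le_rfl abs_h4_mul_vsh_le).theta = thetaX M δ₀ := by
  rw [cutXhv_theta, add_zero]

/-- **THEOREM D FOR THE SHADOW DATUM ON THE DECAYING FRAME** (headline of the module): two DIFFERENT operator
sequences, a genuine smooth cutoff on whose support they agree, and
`|𝔇(T)(I, J)| ≤ 22·θ_X·(256a⁴·1·Kg(δ₀/40))¹⁵·B²·exp(−(δ₀/4)·(|I−J| + β(I) + β(J)))` with `θ_X = thetaX M δ₀ =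
O(M⁻¹)` — volume-free, decaying in the block distance and in both depths to the ramp zone.  Hypotheses `2²⁴ ≤ a`,
`2a ≤ B`, `0 < M`, `I₀ + M < n`, `0 < δ₀ ≤ 1/2`.  OURS. [folklore] -/
theorem XshD_dT_entry (hM : 0 < M) (hIM : I₀ + M < n) (hδ₀ : 0 < δ₀) (hδ : δ₀ ≤ 1 / 2) (I J : Fin n) :
    |(Xsh n B M I₀ a ha haB).dT I J| ≤
      22 * thetaX M δ₀ * (256 * a ^ 4 * 1 * Kg (δ₀ / 40)) ^ 15 * (B : ℝ) ^ (2 : ℤ) *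
        Real.exp (-(δ₀ / 4 * (bdist n I J
          + zoneDepth (bdist n) (rampZone n M I₀) (rampZone_nonempty (lt_of_hIM hIM)) I
          + zoneDepth (bdist n) (rampZone n M I₀) (rampZone_nonempty (lt_of_hIM hIM)) J))) := by
  have h := XhvD_dT_entry (ha := ha) (haB := haB) (hv0 := vsh_nonneg) (hv1 := vsh_le) hM hIM hδ₀ hδ
    (mem_of_vsh_ne_zero (a := a)) le_rfl abs_h4_mul_vsh_le I J
  rw [add_zero] at h
  exact h

/-- the shadow headline with `𝔇(T)` written out. OURS. [folklore] -/
theorem XshD_dT_entry_apply (hM : 0 < M) (hIM : I₀ + M < n) (hδ₀ : 0 < δ₀) (hδ : δ₀ ≤ 1 / 2) (I J : Fin n) :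
    |h4 n B M I₀ (xS (hBnat_of ha haB) I) *
          (Qp n B * Gtoyv n B ((a / B) ^ 2) ((a / B) ^ 2) (vsh n B M I₀ a) * Qpt n B) I J
        - (Qp n B * Gtoy n B ((a / B) ^ 2) ((a / B) ^ 2) * Qpt n B) I J * h4 n B M I₀ (xS (hBnat_of ha haB) J)|
      ≤ 22 * thetaX M δ₀ * (256 * a ^ 4 * 1 * Kg (δ₀ / 40)) ^ 15 * (B : ℝ) ^ (2 : ℤ) *
        Real.exp (-(δ₀ / 4 * (bdist n I J
          + zoneDepth (bdist n) (rampZone n M I₀) (rampZone_nonempty (lt_of_hIM hIM)) I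
          + zoneDepth (bdist n) (rampZone n M I₀) (rampZone_nonempty (lt_of_hIM hIM)) J))) := by
  rw [← Xsh_dT_apply (ha := ha) (haB := haB)]
  exact XshD_dT_entry hM hIM hδ₀ hδ I J

/-- **THE EXPLICIT FORM**: `|𝔇(T)(I, J)| ≤ 22·(48/M)·(20736a⁴/δ₀)¹⁵·B²·exp(−(δ₀/4)·(|I−J| + β(I) + β(J)))`
(Toy14's `thetaX_le`, Toy13's `const_pow_le`) — the `1/M` of p. 414, times the cell's astronomical but
volume-free constant, for two different sequences. OURS. [folklore] -/
theorem XshD_dT_entry_explicit (hM : 0 < M) (hIM : I₀ + M < n) (hδ₀ : 0 < δ₀) (hδ : δ₀ ≤ 1 / 2) (I J : Fin n) :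
    |(Xsh n B M I₀ a ha haB).dT I J| ≤
      22 * (48 / M) * (20736 * a ^ 4 / δ₀) ^ 15 * (B : ℝ) ^ (2 : ℤ) *
        Real.exp (-(δ₀ / 4 * (bdist n I J
          + zoneDepth (bdist n) (rampZone n M I₀) (rampZone_nonempty (lt_of_hIM hIM)) I
          + zoneDepth (bdist n) (rampZone n M I₀) (rampZone_nonempty (lt_of_hIM hIM)) J))) := by
  refine (XshD_dT_entry hM hIM hδ₀ hδ I J).trans ?_
  have hθ := thetaX_le (δ₀ := δ₀) hM (by linarith)
  have hθ0 : 0 ≤ thetaX M δ₀ := thetaX_nonneg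
  have hc := const_pow_le hδ₀ hδ a
  have hc0 : 0 ≤ (256 * a ^ 4 * 1 * Kg (δ₀ / 40)) ^ 15 :=
    pow_nonneg (by have := Kg_nonneg (show 0 < δ₀ / 40 by linarith); positivity) 15
  have hB2 : 0 ≤ (B : ℝ) ^ (2 : ℤ) := zpow_nonneg (Nat.cast_nonneg B) 2
  have he := Real.exp_nonneg (-(δ₀ / 4 * (bdist n I J
          + zoneDepth (bdist n) (rampZone n M I₀) (rampZone_nonempty (lt_of_hIM hIM)) I
          + zoneDepth (bdist n) (rampZone n M I₀) (rampZone_nonempty (lt_of_hIM hIM)) J)))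
  have h1 : 22 * thetaX M δ₀ * (256 * a ^ 4 * 1 * Kg (δ₀ / 40)) ^ 15
      ≤ 22 * (48 / M) * (20736 * a ^ 4 / δ₀) ^ 15 :=
    mul_le_mul (mul_le_mul_of_nonneg_left hθ (by norm_num)) hc hc0 (by positivity)
  exact mul_le_mul_of_nonneg_right (mul_le_mul_of_nonneg_right h1 hB2) he

end Shadow

end

end Literature.MathematicalPhysics.QuantumFieldTheory.Balaban1983to89.B9SectCDiffCutModelToy15
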